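import Mathlib
import HarnessLib
import Summits.NavierStokesRegularity.NavierStokesRegularity.Theorems.WakeRatchetMinimalViscousBlowupWeightedContinuity

/-!
# Route `WakeRatchet`, crux `MinimalViscousBlowup` (stmt-NavierStokesRegularity-22743) — LINE g11-1 «threshold ray» (ns-idea-1 g11), input (E2) of
# STUB-PLAN-regularOpen.md for stub S2 `stub_regularOpen`: CONTINUITY IN THE VISCOSITY on a compact time window, weight `λ^{8k⁺}`

* `weightRatiosLE_weight8` — the weight `w_k = λ^{8 max(k,0)}` is admissible (`WeightRatiosLE ε₀ w λ^{10}`);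
* `weighted_continuity` — **(E2)**: `X` the `ν`-solution with the (4.5) bound `(1+λ^{10k})|X_{i,k}| ≤ M` on `[0,s]`, `Y` any regular `ν'`-solution on
  `[0,s]` (`s ≤ S`) from the same state, both without shells below `0`; if `2^{⌈S(16m²M_αλ^{10}(M+2)+1)⌉+1} M |ν'−ν| ≤ η ≤ 1` then
  `λ^{8k⁺}|Y_{i,k}(t) − X_{i,k}(t)| ≤ η` on `[0,s]` — continuous induction in time on the doubled bound `2η` over the finitely many shells below
  the regular tails, the improvement `≤ η` being the Grönwall bound `weighted_sub_le_of_viscosities` (E2 core) with `B = M+2`, `F = M`.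
MODEL lattice ODEs only; nothing here concerns the Navier–Stokes equations.  `--supports stmt-NavierStokesRegularity-22743 --as helper`.
[cite: Teschl2012, Thm. 2.8 (dependence on parameters); Tao2016AveragedNS, §4 Lemma 4.1 (4.5)]
-/

noncomputable section

-- the summit and its single sub-problem share the name (CONVENTIONS §1)
set_option linter.dupNamespace false

open Set Filter Topology

namespace Summit.NavierStokesRegularity.NavierStokesRegularity.Theorems.MinimalViscousBlowup.ThresholdRay

open Literature.Analysis.FluidPDE Literature.Analysis.FluidPDE.TaoCascade

variable {m : ℕ}

/-! ### §1 The weight `λ^{8k⁺}` is admissible -/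

/-- The weight `w_k = (1+ε₀)^{8 max(k,0)}` has bounded gain/weight ratios: `WeightRatiosLE ε₀ w ((1+ε₀)^{10})`.
[cite: Tao2016AveragedNS, §4 Lemma 4.1 (4.8)–(4.10) (admissible weights)] -/
theorem weightRatiosLE_weight8 {ε₀ : ℝ} (hε₀ : 0 ≤ ε₀) :
    WeightRatiosLE ε₀ (fun k : ℤ => (1 + ε₀) ^ ((8 : ℝ) * ((max k 0 : ℤ) : ℝ))) ((1 + ε₀) ^ (10 : ℝ)) := by
  -- adapted from `weightRatiosLE_aprioriWeight` (Literature/…/ViscousEnvelopeSmoothing.lean)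
  have hl1 : (1 : ℝ) ≤ 1 + ε₀ := by linarith
  have hl0 : (0 : ℝ) < 1 + ε₀ := by linarith
  have hwpos : ∀ k : ℤ, 0 < (1 + ε₀) ^ ((8 : ℝ) * ((max k 0 : ℤ) : ℝ)) := fun k => Real.rpow_pos_of_pos hl0 _
  have key : ∀ a b : ℝ, a - b ≤ 10 → (1 + ε₀) ^ a / (1 + ε₀) ^ b ≤ (1 + ε₀) ^ (10 : ℝ) := by
    intro a b hab
    rw [← Real.rpow_sub hl0]
    exact Real.rpow_le_rpow_of_exponent_le hl1 hab
  refine ⟨hwpos, fun k => ⟨?_, ?_, ?_⟩⟩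
  · refine key _ _ ?_
    rcases le_or_gt 0 k with hk | hk
    · rw [max_eq_left hk]
      have h0 : (0 : ℝ) ≤ k := by exact_mod_cast hk
      linarith
    · rw [max_eq_right hk.le]
      have h0 : (k : ℝ) ≤ 0 := by exact_mod_cast hk.le
      push_cast
      linarith
  · refine key _ _ ?_
    rcases le_or_gt 0 (k + 1) with hk | hk
    · rw [max_eq_left hk]
      have h0 : (-1 : ℝ) ≤ k := by
        have : (-1 : ℤ) ≤ k := by omega
        exact_mod_cast this
      push_cast
      linarith
    · rw [max_eq_right hk.le]
      have h0 : (k : ℝ) ≤ 0 := by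
        have : k ≤ 0 := by omega
        exact_mod_cast this
      push_cast
      linarith
  · show (1 + ε₀) ^ ((5 : ℝ) * ((k : ℝ) - 1) / 2) * (1 + ε₀) ^ ((8 : ℝ) * ((max k 0 : ℤ) : ℝ)) /
        ((1 + ε₀) ^ ((8 : ℝ) * ((max (k - 1) 0 : ℤ) : ℝ))) ^ 2 ≤ (1 + ε₀) ^ (10 : ℝ)
    have hsq : ((1 + ε₀) ^ ((8 : ℝ) * ((max (k - 1) 0 : ℤ) : ℝ))) ^ 2 =
        (1 + ε₀) ^ ((16 : ℝ) * ((max (k - 1) 0 : ℤ) : ℝ)) := by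
      rw [sq, ← Real.rpow_add hl0]; ring_nf
    rw [hsq, ← Real.rpow_add hl0]
    refine key _ _ ?_
    rcases le_or_gt 1 k with hk | hk
    · rw [max_eq_left (by omega : (0 : ℤ) ≤ k), max_eq_left (by omega : (0 : ℤ) ≤ k - 1)]
      have h0 : (1 : ℝ) ≤ k := by exact_mod_cast hk
      push_cast
      linarith
    · rw [max_eq_right (by omega : k - 1 ≤ 0)]
      rcases le_or_gt 0 k with hk' | hk'
      · rw [max_eq_left hk']
        have h0 : (k : ℝ) ≤ 0 := by exact_mod_cast (show k ≤ 0 by omega)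
        have h1 : (0 : ℝ) ≤ k := by exact_mod_cast hk'
        push_cast
        linarith
      · rw [max_eq_right hk'.le]
        have h0 : (k : ℝ) ≤ 0 := by exact_mod_cast hk'.le
        push_cast
        linarith

/-! ### §2 (E2): continuity in the viscosity on a compact window -/

/-- **(E2) CONTINUITY IN THE VISCOSITY, weight `λ^{8k⁺}`.**  Structure constants bounded by `M_α`, `ν' ≥ 0`, `0 < η ≤ 1`, `s ≤ S`.  Let `X` solve
the `ν`-viscous lattice within `[0,s]` with the (4.5) bound `(1+λ^{10k})|X_{i,k}| ≤ M` there, and `Y` the `ν'`-viscous lattice within `[0,s]`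
from the same state at time `0` with some (4.5) bound, both without shells below `0` on `[0,s]`.  If
`2^{⌈S(16 m² M_α λ^{10}(M+2)+1)⌉₊+1} · M · |ν'−ν| ≤ η`, then `λ^{8 max(k,0)}|Y_{i,k}(t) − X_{i,k}(t)| ≤ η` on `[0,s]`.
[cite: Teschl2012, Thm. 2.8 (dependence on parameters); Tao2016AveragedNS, §4 Lemma 4.1 (4.5)] -/
theorem weighted_continuity {ε₀ ν ν' Mα M η s S : ℝ} {α : Fin m → Fin m → Fin m → ℤ × ℤ × ℤ → ℝ}
    (hε : 0 < ε₀) (hMα : 0 ≤ Mα) (hα : ∀ i₁ i₂ i₃ μ, |α i₁ i₂ i₃ μ| ≤ Mα) (hν' : 0 ≤ ν') (hM : 0 ≤ M)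
    (hη : 0 < η) (hη1 : η ≤ 1) (hsS : s ≤ S) {X Y : Fin m → ℤ → ℝ → ℝ}
    (h0 : ∀ i k, X i k 0 = Y i k 0)
    (hlowX : ∀ i k, k < 0 → ∀ t ∈ Icc 0 s, X i k t = 0) (hlowY : ∀ i k, k < 0 → ∀ t ∈ Icc 0 s, Y i k t = 0)
    (hXb : ∀ t ∈ Icc 0 s, ∀ (i : Fin m) (k : ℤ), (1 + (1 + ε₀) ^ ((10 : ℝ) * k)) * |X i k t| ≤ M)
    (hYreg : ∃ M' : ℝ, ∀ t ∈ Icc 0 s, ∀ (i : Fin m) (k : ℤ), (1 + (1 + ε₀) ^ ((10 : ℝ) * k)) * |Y i k t| ≤ M')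
    (hXd : ∀ i k, ∀ t ∈ Icc 0 s, HasDerivWithinAt (X i k)
      (quadTerm ε₀ α X i k t - ν * (1 + ε₀) ^ ((2 : ℝ) * k) * X i k t) (Icc 0 s) t)
    (hYd : ∀ i k, ∀ t ∈ Icc 0 s, HasDerivWithinAt (Y i k)
      (quadTerm ε₀ α Y i k t - ν' * (1 + ε₀) ^ ((2 : ℝ) * k) * Y i k t) (Icc 0 s) t)
    (hsmall : 2 ^ (⌈S * (16 * (m : ℝ) ^ 2 * Mα * (1 + ε₀) ^ (10 : ℝ) * (M + 2) + 1)⌉₊ + 1) * M * |ν' - ν| ≤ η) :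
    ∀ t ∈ Icc 0 s, ∀ i k, (1 + ε₀) ^ ((8 : ℝ) * ((max k 0 : ℤ) : ℝ)) * |Y i k t - X i k t| ≤ η := by
  rcases lt_or_ge s 0 with hs | hs0
  · intro t ht; exact absurd (ht.1.trans ht.2) (not_le.2 hs)
  have hl0 : (0 : ℝ) < 1 + ε₀ := by linarith
  have hl1 : (1 : ℝ) < 1 + ε₀ := by linarith
  have hpow : ∀ a : ℝ, 0 < (1 + ε₀) ^ a := fun a => Real.rpow_pos_of_pos hl0 a
  set w : ℤ → ℝ := fun k => (1 + ε₀) ^ ((8 : ℝ) * ((max k 0 : ℤ) : ℝ)) with hw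
  have hW : WeightRatiosLE ε₀ w ((1 + ε₀) ^ (10 : ℝ)) := weightRatiosLE_weight8 hε.le
  have hwpos : ∀ k, 0 < w k := fun k => hpow _
  -- weight facts
  have hwk : ∀ k : ℤ, 0 ≤ k → w k = (1 + ε₀) ^ ((8 : ℝ) * k) := fun k hk => by
    show (1 + ε₀) ^ ((8 : ℝ) * ((max k 0 : ℤ) : ℝ)) = _
    rw [max_eq_left hk]
  have hX10 : ∀ t ∈ Icc 0 s, ∀ (i : Fin m) (k : ℤ), (1 + ε₀) ^ ((10 : ℝ) * k) * |X i k t| ≤ M := by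
    intro t ht i k
    have h := hXb t ht i k
    nlinarith [abs_nonneg (X i k t), hpow ((10 : ℝ) * k)]
  have hwX : ∀ t ∈ Icc 0 s, ∀ i k, w k * |X i k t| ≤ M := by
    intro t ht i k
    rcases lt_or_ge k 0 with hk | hk
    · rw [hlowX i k hk t ht, abs_zero, mul_zero]; exact hM
    · rw [hwk k hk]
      have hk' : (0 : ℝ) ≤ k := by exact_mod_cast hk
      have h8 : (1 + ε₀) ^ ((8 : ℝ) * k) ≤ (1 + ε₀) ^ ((10 : ℝ) * k) :=
        Real.rpow_le_rpow_of_exponent_le hl1.le (by nlinarith)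
      exact (mul_le_mul_of_nonneg_right h8 (abs_nonneg _)).trans (hX10 t ht i k)
  have hXF : ∀ t ∈ Icc 0 s, ∀ i k, w k * ((1 + ε₀) ^ ((2 : ℝ) * k) * |X i k t|) ≤ M := by
    intro t ht i k
    rcases lt_or_ge k 0 with hk | hk
    · rw [hlowX i k hk t ht, abs_zero, mul_zero, mul_zero]; exact hM
    · rw [hwk k hk, ← mul_assoc, ← Real.rpow_add hl0, show (8 : ℝ) * k + 2 * k = 10 * k by ring]
      exact hX10 t ht i k
  -- the regular tails of the difference
  obtain ⟨M₀', hM₀'⟩ := hYreg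
  set M' : ℝ := max M₀' 0 with hM'
  have hM'0 : 0 ≤ M' := le_max_right _ _
  have hY10 : ∀ t ∈ Icc 0 s, ∀ (i : Fin m) (k : ℤ), (1 + ε₀) ^ ((10 : ℝ) * k) * |Y i k t| ≤ M' := by
    intro t ht i k
    have h := (hM₀' t ht i k).trans (le_max_left M₀' 0)
    nlinarith [abs_nonneg (Y i k t), hpow ((10 : ℝ) * k)]
  have h2 : (1 : ℝ) < (1 + ε₀) ^ (2 : ℝ) := Real.one_lt_rpow hl1 (by norm_num)
  obtain ⟨k₁, hk₁⟩ := pow_unbounded_of_one_lt ((M + M' + 1) / η) h2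
  have htail : ∀ t ∈ Icc 0 s, ∀ (i : Fin m) (k : ℤ), (k₁ : ℤ) ≤ k → w k * |Y i k t - X i k t| ≤ η := by
    intro t ht i k hk
    have hk0 : (0 : ℤ) ≤ k := le_trans (by positivity) hk
    have hk0' : (0 : ℝ) ≤ k := by exact_mod_cast hk0
    rw [hwk k hk0]
    -- `λ^{2k} ≥ (λ²)^{k₁} > (M+M'+1)/η`
    have hge : ((1 + ε₀) ^ (2 : ℝ)) ^ k₁ ≤ (1 + ε₀) ^ ((2 : ℝ) * k) := by
      rw [← Real.rpow_natCast, ← Real.rpow_mul hl0.le]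
      refine Real.rpow_le_rpow_of_exponent_le hl1.le ?_
      have : ((k₁ : ℤ) : ℝ) ≤ (k : ℝ) := by exact_mod_cast hk
      push_cast at this ⊢
      nlinarith
    have hlt : (M + M' + 1) / η < (1 + ε₀) ^ ((2 : ℝ) * k) := hk₁.trans_le hge
    rw [div_lt_iff₀ hη] at hlt
    have hsum : (1 + ε₀) ^ ((10 : ℝ) * k) * |Y i k t - X i k t| ≤ M' + M := by
      have := abs_sub (Y i k t) (X i k t)
      nlinarith [hX10 t ht i k, hY10 t ht i k, hpow ((10 : ℝ) * k)]
    have hsplit : (1 + ε₀) ^ ((10 : ℝ) * k) = (1 + ε₀) ^ ((2 : ℝ) * k) * (1 + ε₀) ^ ((8 : ℝ) * k) := by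
      rw [← Real.rpow_add hl0]; ring_nf
    rw [hsplit, mul_assoc] at hsum
    -- `λ^{2k} · (λ^{8k}|D|) ≤ M + M' < η λ^{2k}`
    by_contra hcon
    have hgt : η < (1 + ε₀) ^ ((8 : ℝ) * k) * |Y i k t - X i k t| := not_le.1 hcon
    have := mul_lt_mul_of_pos_left hgt (hpow ((2 : ℝ) * k))
    nlinarith [hpow ((2 : ℝ) * k)]
  -- continuity on the window, from the derivatives
  have hXc : ∀ i k, ContinuousOn (X i k) (Icc 0 s) := fun i k u hu => (hXd i k u hu).continuousWithinAt
  have hYc : ∀ i k, ContinuousOn (Y i k) (Icc 0 s) := fun i k u hu => (hYd i k u hu).continuousWithinAt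
  -- the history set of the doubled bound on the low shells
  set H : Set ℝ := {t | ∀ τ ∈ Icc 0 t, τ ≤ s → ∀ (i : Fin m) (k : ℤ), 0 ≤ k → k < k₁ →
    w k * |Y i k τ - X i k τ| ≤ 2 * η} with hH
  have hall : ∀ t, t ≤ s → t ∈ H → ∀ τ ∈ Icc 0 t, ∀ i k, w k * |Y i k τ - X i k τ| ≤ 2 * η := by
    intro t hts ht τ hτ i k
    have hτs : τ ∈ Icc 0 s := ⟨hτ.1, hτ.2.trans hts⟩
    rcases lt_or_ge k 0 with hk | hk
    · rw [hlowX i k hk τ hτs, hlowY i k hk τ hτs, sub_self, abs_zero, mul_zero]; positivity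
    · by_cases hk' : k < k₁
      · exact ht τ hτ (hτ.2.trans hts) i k hk hk'
      · exact (htail τ hτs i k (not_lt.1 hk')).trans (by linarith)
  -- the improvement on `[0,t]`, `t ∈ H ∩ [0,s]`: the Grönwall bound with `B = M + 2`, `F = M`
  have himp : ∀ t ∈ Icc 0 s, t ∈ H → ∀ τ ∈ Icc 0 t, ∀ i k, w k * |Y i k τ - X i k τ| ≤ η := by
    intro t ht htH τ hτ i k
    have hsub : Icc 0 t ⊆ Icc 0 s := Icc_subset_Icc_right ht.2
    have hB : 0 ≤ M + 2 := by positivity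
    have hXb' : ∀ u ∈ Icc 0 t, ∀ i k, w k * |X i k u| ≤ M + 2 := fun u hu i k => (hwX u (hsub hu) i k).trans (by linarith)
    have hYb' : ∀ u ∈ Icc 0 t, ∀ i k, w k * |Y i k u| ≤ M + 2 := by
      intro u hu i k
      have h1 := hwX u (hsub hu) i k
      have h2 := hall t ht.2 htH u hu i k
      have h3 : |Y i k u| ≤ |X i k u| + |Y i k u - X i k u| := by
        have := abs_add_le (X i k u) (Y i k u - X i k u); rwa [add_sub_cancel] at this
      nlinarith [hwpos k]
    have hG := weighted_sub_le_of_viscosities (S := S) hl0.le hW hMα hα hν' hB hM (ht.2.trans hsS) h0 hXb' hYb'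
      (fun u hu i k => hXF u (hsub hu) i k) (fun i k u hu => (hXd i k u (hsub hu)).mono hsub)
      (fun i k u hu => (hYd i k u (hsub hu)).mono hsub) τ hτ i k
    exact hG.trans hsmall
  -- `0 ∈ H`
  have h0H : (0 : ℝ) ∈ H := by
    intro τ hτ _ i k _ _
    have hτ0 : τ = 0 := le_antisymm hτ.2 hτ.1
    subst hτ0
    rw [← h0, sub_self, abs_zero, mul_zero]; positivity
  -- the history set is closed in `[0,s]` (clamped times)
  set c : ℝ → ℝ → ℝ := fun τ t => max (min τ t) 0 with hc
  have hcc : ∀ τ, Continuous (c τ) := fun τ => (continuous_const.min continuous_id).max continuous_const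
  have hcmem : ∀ τ ∈ Icc (0 : ℝ) s, ∀ t, c τ t ∈ Icc 0 s := fun τ hτ t =>
    ⟨le_max_right _ _, max_le ((min_le_left _ _).trans hτ.2) hs0⟩
  have hclosed : IsClosed (H ∩ Icc 0 s) := by
    have heq : H ∩ Icc 0 s = Icc 0 s ∩ ⋂ τ ∈ Icc (0 : ℝ) s, ⋂ (i : Fin m), ⋂ (k : ℤ),
        {t : ℝ | 0 ≤ k → k < k₁ → w k * |Y i k (c τ t) - X i k (c τ t)| ≤ 2 * η} := by
      ext t
      simp only [hH, mem_inter_iff, mem_iInter, mem_setOf_eq]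
      constructor
      · rintro ⟨ht, hts⟩
        refine ⟨hts, fun τ hτ i k hk hk' => ?_⟩
        have hct : c τ t = min τ t := max_eq_left (le_min hτ.1 hts.1)
        rw [hct]
        exact ht (min τ t) ⟨le_min hτ.1 hts.1, min_le_right _ _⟩ ((min_le_right _ _).trans hts.2) i k hk hk'
      · rintro ⟨hts, h⟩
        refine ⟨fun τ hτ hτs i k hk hk' => ?_, hts⟩
        have := h τ ⟨hτ.1, hτs⟩ i k hk hk'
        have hct : c τ t = τ := by
          show max (min τ t) 0 = τ
          rw [min_eq_left hτ.2, max_eq_left hτ.1]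
        rwa [hct] at this
    rw [heq]
    refine isClosed_Icc.inter (isClosed_biInter fun τ hτ => isClosed_iInter fun i => isClosed_iInter fun k => ?_)
    by_cases hk : 0 ≤ k ∧ k < k₁
    · have : {t : ℝ | 0 ≤ k → k < k₁ → w k * |Y i k (c τ t) - X i k (c τ t)| ≤ 2 * η} =
          {t : ℝ | w k * |Y i k (c τ t) - X i k (c τ t)| ≤ 2 * η} := by
        ext t
        simp only [mem_setOf_eq]
        exact ⟨fun h => h hk.1 hk.2, fun h _ _ => h⟩
      rw [this]
      have hYX : Continuous fun t => Y i k (c τ t) - X i k (c τ t) :=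
        ((hYc i k).comp_continuous (hcc τ) (hcmem τ hτ)).sub ((hXc i k).comp_continuous (hcc τ) (hcmem τ hτ))
      exact isClosed_le (continuous_const.mul (continuous_abs.comp hYX)) continuous_const
    · have : {t : ℝ | 0 ≤ k → k < k₁ → w k * |Y i k (c τ t) - X i k (c τ t)| ≤ 2 * η} = univ := by
        ext t
        simp only [mem_setOf_eq, mem_univ, iff_true]
        exact fun h1 h2 => absurd ⟨h1, h2⟩ hk
      rw [this]
      exact isClosed_univ
  -- the history set opens to the right: strict improved bound + continuity within `[0,s]` on finitely many shells
  have hstep : ∀ x ∈ H ∩ Ico (0 : ℝ) s, H ∈ 𝓝[>] x := by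
    rintro x ⟨hxH, hx⟩
    have hxs : x ∈ Icc 0 s := ⟨hx.1, hx.2.le⟩
    have himpx := himp x hxs hxH
    have hev : ∀ᶠ y in 𝓝[Icc 0 s] x, ∀ (i : Fin m), ∀ k ∈ Finset.Ico (0 : ℤ) k₁,
        w k * |Y i k y - X i k y| < 2 * η := by
      refine eventually_all.2 fun i => (eventually_all_finset _).2 fun k _ => ?_
      have hlt : w k * |Y i k x - X i k x| < 2 * η := lt_of_le_of_lt (himpx x ⟨hx.1, le_rfl⟩ i k) (by linarith)
      have hcw : ContinuousWithinAt (fun y => w k * |Y i k y - X i k y|) (Icc 0 s) x :=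
        continuousWithinAt_const.mul
          (continuous_abs.continuousAt.comp_continuousWithinAt ((hYc i k x hxs).sub (hXc i k x hxs)))
      exact Filter.Tendsto.eventually_lt hcw tendsto_const_nhds hlt
    obtain ⟨δ, hδ, hball⟩ := Metric.mem_nhdsWithin_iff.1 hev
    have hsub : Ioo x (x + δ) ⊆ H := by
      intro y hy τ hτ hτs i k hk hk'
      rcases le_or_gt τ x with hτx | hτx
      · exact hxH τ ⟨hτ.1, hτx⟩ hτs i k hk hk'
      · have hmem : τ ∈ Metric.ball x δ ∩ Icc 0 s := by
          refine ⟨?_, hτ.1, hτs⟩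
          rw [Metric.mem_ball, Real.dist_eq, abs_of_pos (by linarith)]
          linarith [hτ.2, hy.2]
        exact (hball hmem i k (Finset.mem_Ico.2 ⟨hk, hk'⟩)).le
    exact mem_of_superset (Ioo_mem_nhdsGT (by linarith : x < x + δ)) hsub
  -- continuous induction
  have hIcc : Icc 0 s ⊆ H := hclosed.Icc_subset_of_forall_mem_nhdsWithin h0H hstep
  intro t ht i k
  exact himp t ht (hIcc ht) t ⟨ht.1, le_rfl⟩ i k

end Summit.NavierStokesRegularity.NavierStokesRegularity.Theorems.MinimalViscousBlowup.ThresholdRay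

end
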